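import Mathlib.Algebra.Algebra.Basic
import Mathlib.Algebra.Group.Invertible.Basic
import Mathlib.Algebra.Ring.Idempotent
import Mathlib.Tactic.LinearCombination
import Mathlib.Tactic.Ring
import Mathlib.Tactic.NormNum
import HarnessLib

/-!
# Fixed units are norms when a ring endomorphism swaps an idempotent with its complement

Let `L` be a commutative ring and `ρ : L →+* L` a ring endomorphism (typically an involution:
the non-trivial automorphism of a quadratic étale algebra `L` over its fixed ring `T = L^ρ`).
Suppose `L` contains an idempotent `f` with `ρ f = 1 - f` ("`ρ` swaps `f` and its complement";
for an involution of a finite étale algebra over a field this says that `ρ` permutes the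
primitive idempotents WITHOUT fixed points, i.e. `L ≅ T × T` with `ρ` the swap). Then:

* `mul_map_eq_of_isIdempotentElem` — for every `ρ`-fixed `t` the element `a := f t + (1 - f)`
  satisfies `a · ρ a = t`; if `t` is a unit so is `a` (`isUnit_idempotentTwist`). Hence
  **every `ρ`-fixed unit is a `ρ`-norm** (`exists_isUnit_mul_map_eq`): the norm map
  `Lˣ → (L^ρ)ˣ`, `a ↦ a · ρ a`, is surjective — the split case of Hilbert's Theorem 90 / of the
  vanishing of `T^× / N(L^×)`.
* `exists_isUnit_eq_mul_norm_of_map_eq_neg` — the anti-invariant form: if `β₀, β₁` are units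
  with `ρ β₀ = -β₀`, `ρ β₁ = -β₁`, then `β₀ = β₁ · (a · ρ a)` for a unit `a`.
* `isIdempotentElem_half_one_add` / `map_half_one_add` — the usual source of such an `f`: an
  anti-invariant square root of unity `u` (`u * u = 1`, `ρ u = -u`) gives `f = (1 + u)/2` when
  `2` is invertible.

Application (recorded here only as motivation; nothing below depends on it): for CM fields
`K ⊇ k₁` and a field `E` containing all conjugates of `k₁`, the algebra `L = K ⊗_ℚ E` with
`ρ = (conj) ⊗ 1` contains such an `f` (from `k₁ ⊗_ℚ E ≅ E^{Hom(k₁,E)}`, on whose idempotents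
`ρ` acts freely), so every hermitian unit of `K ⊗_ℚ E` is a norm and every anti-hermitian unit
`β₀` is `(β ⊗ 1) · a · ρ a` with `β ∈ K` anti-invariant — the normalisation asked of the de Rham
rigidification `r_μ` in Y. Liu, *Fourier–Jacobi cycles and arithmetic relative trace formula*,
Camb. J. Math. 9 (2021), Def. 4.5 (2) («the existence of `r_μ` is obvious», proof of Prop. 4.6).
The field-theoretic supplier of `f` is `Summits/HodgeConjecture/CorCM/RMuNormOddUnit.lean`, the
CM / Liu reading `Summits/HodgeConjecture/CorCM/RMuNormHermitianUnits.lean` (cell pub-hodgecm2,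
lane RMU-NORM: the norm obstruction behind the last posited token `R` of the S7 END display).

All statements are elementary commutative algebra (placed under the cell's `CorCM/` tree as cell
mathematics; nothing here is specific to the Hodge conjecture). See also
`Literature/NumberTheory/Automorphic/Liu2021/Def45RMuGalois.lean` (seat hcmisog-isog-2), which
files the Liu-level reading (`M_μ`, `M'_μ`, Def. 4.5 (2) bullet 4) of the same mechanism; by the
cell's coordination rule this file and its two sequels state only the general algebra. [folklore]
-/

namespace Summit.HodgeConjecture.CorCM.RMuNorm

variable {L : Type*} [CommRing L]

/-- If `ρ f = 1 - f` and `ρ t = t` then `ρ (f t + (1 - f)) = (1 - f) t + f`. [folklore] -/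
theorem map_idempotentTwist (ρ : L →+* L) {f t : L} (hρf : ρ f = 1 - f) (ht : ρ t = t) :
    ρ (f * t + (1 - f)) = (1 - f) * t + f := by
  simp only [map_add, map_mul, map_sub, map_one, hρf, ht, sub_sub_cancel]

/-- **Core identity.** If `f` is idempotent, `ρ f = 1 - f` and `ρ t = t`, then with
`a := f t + (1 - f)` (equal to `t` on the `f`-component and to `1` on the complementary one)
one has `a * ρ a = t`: indeed `ρ a = (1 - f) t + f`, and
`(f t + (1 - f)) ((1 - f) t + f) = f (1 - f) t² + f² t + (1 - f)² t + (1 - f) f = f t + (1 - f) t = t`.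
[folklore] -/
theorem mul_map_eq_of_isIdempotentElem (ρ : L →+* L) {f : L} (hf : IsIdempotentElem f)
    (hρf : ρ f = 1 - f) {t : L} (ht : ρ t = t) :
    (f * t + (1 - f)) * ρ (f * t + (1 - f)) = t := by
  rw [map_idempotentTwist ρ hρf ht]
  linear_combination (-(t - 1) ^ 2) * hf.eq

/-- The twist of a unit by an idempotent is a unit: `(f t + (1 - f)) (f t⁻¹ + (1 - f)) = 1`.
[folklore] -/
theorem isUnit_idempotentTwist {f : L} (hf : IsIdempotentElem f) {t : L} (htu : IsUnit t) :
    IsUnit (f * t + (1 - f)) := by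
  obtain ⟨s, hs⟩ := htu.exists_right_inv
  refine IsUnit.of_mul_eq_one (f * s + (1 - f)) ?_
  linear_combination (2 - t - s) * hf.eq + (f * f) * hs

/-- **Every `ρ`-fixed unit is a `ρ`-norm** when `ρ` swaps an idempotent with its complement:
if `f² = f`, `ρ f = 1 - f`, and `t` is a unit with `ρ t = t`, then `t = a * ρ a` for some unit
`a` (namely `a = f t + (1 - f)`). In words: the norm map `a ↦ a · ρ(a)` from `Lˣ` to the
`ρ`-fixed units is surjective — the split case of the vanishing of `T^×/N(L^×)` for a quadratic
étale algebra `L/T`. [folklore] -/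
theorem exists_isUnit_mul_map_eq (ρ : L →+* L) {f : L} (hf : IsIdempotentElem f)
    (hρf : ρ f = 1 - f) {t : L} (htu : IsUnit t) (ht : ρ t = t) :
    ∃ a : L, IsUnit a ∧ a * ρ a = t :=
  ⟨f * t + (1 - f), isUnit_idempotentTwist hf htu, mul_map_eq_of_isIdempotentElem ρ hf hρf ht⟩

/-- A ring homomorphism sends the inverse of a unit to the inverse of the image:
`ρ ↑u⁻¹ * ρ ↑u = 1`. [folklore] -/
theorem map_units_inv_mul (ρ : L →+* L) (u : Lˣ) : ρ ↑u⁻¹ * ρ ↑u = 1 := by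
  rw [← map_mul, Units.inv_mul, map_one]

/-- **Anti-invariant normalisation.** If `f² = f`, `ρ f = 1 - f`, and `β₀`, `β₁` are units with
`ρ β₀ = -β₀` and `ρ β₁ = -β₁`, then `β₀ = β₁ * (a * ρ a)` for some unit `a`: the quotient
`t = β₀ β₁⁻¹` is a `ρ`-fixed unit, hence a norm by `exists_isUnit_mul_map_eq`. (For
`L = K ⊗ E`, `ρ = conj ⊗ 1`, `β₁ = β ⊗ 1` this is the normal form
`β₀ = (β ⊗ 1) · a · ρ a` of an anti-hermitian unit.) [folklore] -/
theorem exists_isUnit_eq_mul_norm_of_map_eq_neg (ρ : L →+* L) {f : L} (hf : IsIdempotentElem f)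
    (hρf : ρ f = 1 - f) {β₀ β₁ : L} (hβ₀ : IsUnit β₀) (hρβ₀ : ρ β₀ = -β₀) (hβ₁ : IsUnit β₁)
    (hρβ₁ : ρ β₁ = -β₁) : ∃ a : L, IsUnit a ∧ β₀ = β₁ * (a * ρ a) := by
  obtain ⟨u₁, rfl⟩ := hβ₁
  have ht : ρ (β₀ * ↑u₁⁻¹) = β₀ * ↑u₁⁻¹ := by
    have hinv : ρ ↑u₁⁻¹ = -↑u₁⁻¹ := by
      have h1 := map_units_inv_mul ρ u₁
      rw [hρβ₁, mul_neg, ← neg_mul] at h1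
      have h3 : (↑u₁⁻¹ : L) = -ρ ↑u₁⁻¹ := Units.inv_eq_of_mul_eq_one_left h1
      linear_combination h3
    rw [map_mul, hρβ₀, hinv, neg_mul_neg]
  obtain ⟨a, ha, hat⟩ :=
    exists_isUnit_mul_map_eq ρ hf hρf (hβ₀.mul (Units.isUnit u₁⁻¹)) ht
  exact ⟨a, ha, by rw [hat, mul_left_comm, Units.mul_inv, mul_one]⟩

section Half

variable [Invertible (2 : L)]

/-- If `2` is invertible, `u² = 1` makes `f = (1 + u)/2` an idempotent:
`f² = (1 + 2u + u²)/4 = (2 + 2u)/4 = f`. [folklore] -/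
theorem isIdempotentElem_half_one_add {u : L} (hu : u * u = 1) :
    IsIdempotentElem (⅟(2 : L) * (1 + u)) := by
  have h2 : ⅟(2 : L) * 2 = 1 := invOf_mul_self _
  change (⅟(2 : L) * (1 + u)) * (⅟(2 : L) * (1 + u)) = _
  linear_combination (⅟(2 : L) * (1 + u)) * h2 + (⅟(2 : L) * ⅟(2 : L)) * hu

/-- A ring endomorphism fixes `⅟2`. [folklore] -/
theorem map_invOf_two (ρ : L →+* L) : ρ (⅟(2 : L)) = ⅟(2 : L) := by
  have h : ρ (⅟(2 : L)) * 2 = 1 := by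
    have := congrArg ρ (invOf_mul_self (2 : L))
    rwa [map_mul, map_ofNat, map_one] at this
  calc ρ (⅟(2 : L)) = ρ (⅟(2 : L)) * 2 * ⅟(2 : L) := by rw [mul_assoc, mul_invOf_self, mul_one]
    _ = ⅟(2 : L) := by rw [h, one_mul]

/-- If moreover `ρ u = -u` for a ring endomorphism `ρ`, then `ρ f = 1 - f` for `f = (1 + u)/2`.
[folklore] -/
theorem map_half_one_add (ρ : L →+* L) {u : L} (hρu : ρ u = -u) :
    ρ (⅟(2 : L) * (1 + u)) = 1 - ⅟(2 : L) * (1 + u) := by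
  have h2 : ⅟(2 : L) * 2 = 1 := invOf_mul_self _
  rw [map_mul, map_invOf_two, map_add, map_one, hρu]
  linear_combination h2

/-- **Fixed units are norms, from an anti-invariant square root of unity.** In a commutative
ring `L` with `2` invertible and a ring endomorphism `ρ`, if some `u` satisfies `u² = 1` and
`ρ u = -u`, then every `ρ`-fixed unit `t` is `a * ρ a` for a unit `a`. [folklore] -/
theorem exists_isUnit_mul_map_eq_of_sq_eq_one (ρ : L →+* L) {u : L} (hu : u * u = 1)
    (hρu : ρ u = -u) {t : L} (htu : IsUnit t) (ht : ρ t = t) :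
    ∃ a : L, IsUnit a ∧ a * ρ a = t :=
  exists_isUnit_mul_map_eq ρ (isIdempotentElem_half_one_add hu) (map_half_one_add ρ hρu) htu ht

/-- **Anti-invariant normalisation, from an anti-invariant square root of unity.** In a
commutative ring `L` with `2` invertible, a ring endomorphism `ρ` and some `u` with `u² = 1`,
`ρ u = -u`: any two anti-invariant units `β₀, β₁` (`ρ βᵢ = -βᵢ`) differ by a norm,
`β₀ = β₁ * (a * ρ a)` with `a` a unit. [folklore] -/
theorem exists_isUnit_eq_mul_norm_of_sq_eq_one (ρ : L →+* L) {u : L} (hu : u * u = 1)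
    (hρu : ρ u = -u) {β₀ β₁ : L} (hβ₀ : IsUnit β₀) (hρβ₀ : ρ β₀ = -β₀) (hβ₁ : IsUnit β₁)
    (hρβ₁ : ρ β₁ = -β₁) : ∃ a : L, IsUnit a ∧ β₀ = β₁ * (a * ρ a) :=
  exists_isUnit_eq_mul_norm_of_map_eq_neg ρ (isIdempotentElem_half_one_add hu)
    (map_half_one_add ρ hρu) hβ₀ hρβ₀ hβ₁ hρβ₁

end Half

end Summit.HodgeConjecture.CorCM.RMuNorm
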